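import Mathlib
import HarnessLib
import Summits.HubbardSuperconductivity.HubbardSuperconductivity.Theorems.KLProgrammeKLRegimeEngineV8IsoTupleExportW
import Summits.HubbardSuperconductivity.HubbardSuperconductivity.Theorems.KLProgrammeKLRegimeEngineIsoTupleLineZero
import Summits.HubbardSuperconductivity.HubbardSuperconductivity.Theorems.KLProgrammeKLRegimeEngineV8DefsG8

/-!
# Route `KLProgramme` — ENGINE child gen 8 (stmt-HubbardSuperconductivity-20437 `KLRegimeEngineV17F2`), SKELETON v2 class #6: the scale-0 package
# `(a₀, b₀, u₀) = (klIsoT⁴/2, klIsoT⁴·klScaleZeroValC R/192, klEngU₀3 P R cc/Klam²)` IS admissible at `CF := klEngGeo8.CF` and the W-Step's n = 0 case holds for it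
# (plan g19 (R59j)(iii) «the n = 0 corner is moot», numbers; cell gate-hubbard-kl, seat hubbard-kl-k3c2-p2 g9 = class-#6 text owner)

* `two_pow_mul_klIsoT_pow_four_le_klEngGeo8_CF` — `2^28·klIsoT⁴ ≤ klEngGeo8.CF` (the `rfl` chain Geo8 = Geo7 = Geo6 = Geo5 = Geo4.scaleGains 2^28 and `klIsoT⁴ ≤ klEngGeo4.CF`);
* **`isIsoPkgW_scaleZero`** — `R.WF ⟹ IsIsoPkgW P klEngGeo8.CF (klIsoT⁴/2, klIsoT⁴·klScaleZeroValC R/192, fun cc => klEngU₀3 P R cc/Klam²)`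
  (`klScaleZeroValC R·klEngU₀3 ≤ 1/4`, so the fit is `klIsoT⁴·(1/2 + 1/768) ≤ 2^27·klIsoT⁴`);
* **`isoTupleLineStepW_scaleZero_case`** — the W-Step's n = 0 instance for that package: under the Step's own binders at `n = 0`
  (`cc ≤ klEngC₃6`, `U ≤ klEngU₀10`, `klEngL₄ ≤ L`, `klEngM₃ ≤ M`, `FrameOK … (K_0)`; the weighted datum and the empty iso history unused)
  `IsoTupleLineAt L M (klIsoT⁴/2) (klIsoT⁴·klScaleZeroValC R/192) P β U μ 0` (= `isoTupleLineAt_zero_of_klEngU₀10`);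
* §2 (appended) `IsIsoPkgW.mono_CF`, `isIsoPkgW_scaleZero_of_le` — the rows survive any CF-raise (contingent token #22).

Pure bookkeeping; nothing about the model is asserted beyond the named scale-0 facts; nothing asserts superconductivity.
-/

noncomputable section

namespace Summit.HubbardSuperconductivity.HubbardSuperconductivity.Theorems.KLRegimeSplit

set_option linter.dupNamespace false -- summit = problem name (single-conjunct summit), D-0017

open Real Finset Literature.MathematicalPhysics.QuantumLattice Literature.Probability.LatticeModels
open Summit.HubbardSuperconductivity.HubbardSuperconductivity.Theorems.KLProgrammeLegKernels
open Summit.HubbardSuperconductivity.HubbardSuperconductivity.Theorems.EngineV8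

/-- **`2^28·klIsoT⁴ ≤ klEngGeo8.CF`** (Geo8 = Geo7 = Geo6 = Geo5 = `klEngGeo4.scaleGains 2^28` on the `CF` field; `klIsoT⁴ ≤ klEngGeo4.CF`). -/
theorem two_pow_mul_klIsoT_pow_four_le_klEngGeo8_CF : (2 : ℝ) ^ 28 * klIsoT ^ 4 ≤ klEngGeo8.CF := by
  have h : klEngGeo8.CF = 2 ^ 28 * klEngGeo4.CF := by
    rw [klEngGeo8_CF, klEngGeo7_CF, klEngGeo6_CF, klEngGeo5_CF]
  rw [h]
  exact mul_le_mul_of_nonneg_left klIsoT_pow_four_le_klEngGeo4_CF (by positivity)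

/-- **The scale-0 package is admissible at `klEngGeo8.CF`**: `IsIsoPkgW P klEngGeo8.CF (klIsoT⁴/2, klIsoT⁴·klScaleZeroValC R/192, fun cc => klEngU₀3 P R cc/Klam²)`
for every `P` with `1 ≤ Klam` and well-formed `R`. -/
theorem isIsoPkgW_scaleZero {P : SplitConsts} (hP : P.WF) {R : RenConsts} (hR : R.WF) :
    IsIsoPkgW P klEngGeo8.CF (klIsoT ^ 4 / 2, klIsoT ^ 4 * klScaleZeroValC R / 192, fun cc => klEngU₀3 P R cc / P.Klam ^ 2) := by
  have hT4 : 0 ≤ klIsoT ^ 4 := pow_nonneg klIsoT_nonneg 4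
  have hV0 : 0 ≤ klScaleZeroValC R := (klScaleZeroValC_pos (hR.2.2 0)).le
  have hK1 : 1 ≤ P.Klam := hP.1
  have hK2 : 0 < P.Klam ^ 2 := by positivity
  refine ⟨by positivity, by positivity, fun cc => ⟨div_pos (klEngU₀3_pos P R cc) hK2, ?_⟩⟩
  have hVu : klScaleZeroValC R * klEngU₀3 P R cc ≤ 1 / 4 :=
    klScaleZeroValC_mul_le_quarter_of_le_klEngU₀3 (P := P) (c := cc) hR (klEngU₀3_pos P R cc) le_rfl
  have hCF := two_pow_mul_klIsoT_pow_four_le_klEngGeo8_CF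
  have e : klIsoT ^ 4 / 2 + klIsoT ^ 4 * klScaleZeroValC R / 192 * P.Klam ^ 2 * (klEngU₀3 P R cc / P.Klam ^ 2) =
      klIsoT ^ 4 / 2 + klIsoT ^ 4 / 192 * (klScaleZeroValC R * klEngU₀3 P R cc) := by
    field_simp
  show klIsoT ^ 4 / 2 + klIsoT ^ 4 * klScaleZeroValC R / 192 * P.Klam ^ 2 * (klEngU₀3 P R cc / P.Klam ^ 2) ≤ klEngGeo8.CF / 2
  rw [e]
  have h1 : klIsoT ^ 4 / 192 * (klScaleZeroValC R * klEngU₀3 P R cc) ≤ klIsoT ^ 4 / 192 * (1 / 4) :=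
    mul_le_mul_of_nonneg_left hVu (by positivity)
  nlinarith

/-- **The W-Step's n = 0 case for the scale-0 package** (its binders at `n = 0`; `hwt` / `hiso` unused): `IsoTupleLineAt … 0`. -/
theorem isoTupleLineStepW_scaleZero_case {L M : ℕ} [NeZero L] [NeZero M] (P : SplitConsts) (R : RenConsts) (hP : P.WF) (hR : R.WF2)
    {cc : ℝ} (hcc : 0 < cc) (hcc6 : cc ≤ klEngC₃6 P R) {μ : ℝ} (hμ : μ ∈ klWindowC) {U : ℝ} (hU : 0 < U) (hU10 : U ≤ klEngU₀10 P R cc)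
    {β : ℝ} (hβ : klBetaMin ≤ β) (hβc : β ≤ Real.exp (cc / U ^ 2)) (hL : klEngL₄ P R β U ≤ L) (hM : klEngM₃ β U L ≤ M)
    (hK : FrameOK R U (nScales β) μ (klFlowFrameU L M β U μ 0)) :
    IsoTupleLineAt L M (klIsoT ^ 4 / 2) (klIsoT ^ 4 * klScaleZeroValC R / 192) P β U μ 0 :=
  isoTupleLineAt_zero_of_klEngU₀10 P R cc hP hR hcc (hcc6.trans (klEngC₃6_le_klEngC₃3 P R)) μ hμ U hU hU10 β hβ hβc hL hM hK

/-! ## §2 (appended) CF-monotonicity: the rows survive any CF-raise (contingent token #22, `klEngGeo9 := klEngGeo8.raiseCF _`) -/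

/-- **Admissibility is monotone in the fit constant**: `IsIsoPkgW P CF e → CF ≤ CF' → IsIsoPkgW P CF' e`. -/
theorem IsIsoPkgW.mono_CF {P : SplitConsts} {CF CF' : ℝ} {e : ℝ × ℝ × (ℝ → ℝ)} (h : IsIsoPkgW P CF e) (hCF : CF ≤ CF') :
    IsIsoPkgW P CF' e :=
  ⟨h.1, h.2.1, fun cc => ⟨(h.2.2 cc).1, (h.2.2 cc).2.trans (by linarith)⟩⟩

/-- **The scale-0 package is admissible at every `CF ≥ klEngGeo8.CF`** (in particular at a `raiseCF`-table's `CF`). -/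
theorem isIsoPkgW_scaleZero_of_le {P : SplitConsts} (hP : P.WF) {R : RenConsts} (hR : R.WF) {CF : ℝ} (hCF : klEngGeo8.CF ≤ CF) :
    IsIsoPkgW P CF (klIsoT ^ 4 / 2, klIsoT ^ 4 * klScaleZeroValC R / 192, fun cc => klEngU₀3 P R cc / P.Klam ^ 2) :=
  (isIsoPkgW_scaleZero hP hR).mono_CF hCF

end Summit.HubbardSuperconductivity.HubbardSuperconductivity.Theorems.KLRegimeSplit

end
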